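import Literature.Barriers.QuantumAdvantage.TensorNetworkContractionConeReduction
import Literature.Computability.QuantumComplexity.ConeSimCorrect
import HarnessLib

/-!
# Markov–Shi Cor. 1.5 at the language level (identity wire order): discharged

Sibling proof file of the barrier catalogue entry
`Literature/Barriers/QuantumAdvantage/TensorNetworkContraction.lean` (named fact
`markovShi2008_cor15`: a language decided with error `≤ 1/3` by a polynomial-time uniform,
polynomial-size, oracle-free family of Clifford+`T` circuits which are `q`-local-interacting under
the identity ordering of the wires and of depth `≤ c log₂ n + c` is in `P`). The proof is the
light-cone reading recorded in that file's audit (`scope_caveats` (b)), fully formalised: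

* the acceptance probability of wire `0` is that of the gates inside any window containing the
  backward light cone of wire `0` (`LightCone.acceptProb_eq_acceptProb_filter_subset`,
  `LightCone.lean` / `LightConeFilter.lean`), and under `q`-locality for the identity ordering that
  cone lies on the wires `≤ q · depth` (`LightCone.cone_window`), hence inside `[0, K₀)`,
  `K₀ = qc (|bin n| + 1) + 1 > q (c log₂ n + c)` (`cone_subset_window_of_local_logDepth`);
* the windowed circuit lives on `2^{min K₀ N} ≤ 2 (4n+2)^{qc}` basis labels and is simulated
  EXACTLY over `ℤ[ω]/√2^h` by the polynomial-time TM2 decider of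
  `ConeSimStep/Model/Loop/Front/Correct.lean` (`ConeSim.deciderF ∈ FP`,
  `ConeSim.deciderF_correct`: its output is `[p(x) > 1/2]`, through `StateVectorDP.dpRun_spec` and
  the exact sign test `half_lt_probAcc_iff`), so the threshold language is in `P`
  (`ConeSim.polyTimeDecidable_of_cone_subset_window`), and it equals `L` under the `(2/3, 1/3)` gap
  (`setOf_half_lt_eq_of_gap`).

So `markovShi2008_cor15_holds`. (The ordering-free form `markovShi2008_cor15_anyOrder` and the
machine fact `smallConeDecidable` of `TensorNetworkContractionConeReduction.lean` need the
mask-window front end instead of the prefix window and are not discharged here.)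

## References

* I. L. Markov, Y. Shi, *Simulating quantum computation by contracting tensor networks*, SIAM J.
  Comput. 38 (2008) 963–981, §1 (Cor. 1.5: "if `C` is a polynomial-size local-interacting circuit
  with a logarithmic depth, then it can be simulated deterministically in polynomial time";
  deterministic simulation = the exact outcome probability) and §5 ("`r = O(qD)`").
* M. A. Nielsen, I. L. Chuang, *Quantum Computation and Quantum Information*, CUP 2010, §4.5.5.
-/

noncomputable section

namespace Literature.Barriers.QuantumAdvantage

open _root_.Computability Literature.Computability.Complexity Literature.Computability.Complexity.Classes
  Literature.Computability.Cryptography Literature.Computability.QuantumComplexity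

/-- **The light cone of wire `0` of a `q`-local (identity ordering) circuit of depth
`≤ c log₂ n + c` lies inside the window `[0, K₀)`, `K₀ = qc (|bin n| + 1) + 1`**
(`LightCone.cone_window` with the identity ordering: every cone wire is `≤ q · depth`, and
`log₂ n ≤ |bin n|`). [cite: MarkovShi2008, §5 (r = O(qD))] -/
theorem cone_subset_window_of_local_logDepth {q c : ℕ} {F : QCircuitFamily cliffordT}
    (hLoc : ∀ n, (F.circ n).IsLocalInteracting q) (hD : ∀ n, (F.circ n).depth ≤ c * Nat.log 2 n + c)
    (n : ℕ) (h : 0 < n + F.ancillas n) :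
    (LightCone.cone (F.circ n).gates {⟨0, h⟩}).1 ⊆ ConeSim.window (ConeSim.kay0 q c n) (n + F.ancillas n) := by
  intro w hw
  have hwin := LightCone.cone_window (Equiv.refl _) q (⟨0, h⟩ : Fin (n + F.ancillas n)) (F.circ n).depth
    (F.circ n).gates (fun _ => 0) (fun g hg i hi j hj => by simpa using hLoc n g hg i hi j hj)
    (fun w' => Finset.le_sup (f := QCircuit.depthAux (F.circ n).gates fun _ => 0) (Finset.mem_univ w')) w hw
  have h1 : (w : ℕ) ≤ q * (F.circ n).depth := by simpa using hwin.1
  have h2 : q * (F.circ n).depth ≤ q * (c * (encodeNat n).length + c) :=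
    Nat.mul_le_mul_left q ((hD n).trans (by
      have := Nat.mul_le_mul_left c (ConeSim.log_le_length_encodeNat n); omega))
  rw [ConeSim.mem_window]
  unfold ConeSim.kay0
  have : q * (c * (encodeNat n).length + c) = q * c * ((encodeNat n).length + 1) := by ring
  omega

/-- **Discharge of `markovShi2008_cor15`** (Markov–Shi 2008, Cor. 1.5 at the language level,
identity wire ordering): the light cone of wire `0` lies in the window `[0, K₀)`
(`cone_subset_window_of_local_logDepth`), the windowed circuit is simulated exactly in polynomial
time (`ConeSim.polyTimeDecidable_of_cone_subset_window`), and the threshold language is `L` under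
the gap (`setOf_half_lt_eq_of_gap`), so `L ∈ P` (`mem_P_iff_holds`).
[cite: MarkovShi2008, §1 (Cor. 1.5)] -/
theorem markovShi2008_cor15_holds : markovShi2008_cor15 := by
  intro q c F L hOF hU _hPS hLoc hD hDec
  have h := ConeSim.polyTimeDecidable_of_cone_subset_window q c hOF hU (cone_subset_window_of_local_logDepth hLoc hD)
  rw [setOf_half_lt_eq_of_gap hDec] at h
  exact mem_P_iff_holds.2 h

end Literature.Barriers.QuantumAdvantage

end
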